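import Summits.RiemannHypothesis.RiemannHypothesis.Theses.WeilComb
import Summits.RiemannHypothesis.RiemannHypothesis.Theorems.WeilCombCombShapePositivityExactPrimeWindow
import Summits.RiemannHypothesis.RiemannHypothesis.Theorems.WeilCombCombShapePositivityPolarExact
import Summits.RiemannHypothesis.RiemannHypothesis.Theorems.WeilCombCombShapePositivityArchGram
import Literature.NumberTheory.LFunctions.WeilExplicit
import Literature.NumberTheory.LFunctions.WeilMellinBounds

/-!
# The exact three-term identity on the window `2ε(M+1) ≤ 1`, in closed (matrix) form
(crux `WeilComb.CombShapePositivity`, item stmt-RiemannHypothesis-11229, line `Sketch`; the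
"ExactWindowIdentity" layer of the route's Theorem B = stub `stub_window`)

Notation: `φ₀(u) = expNegInvGlue (1 - u²)`, `φ_ε(t) = ε⁻¹ φ₀(t/ε)`, `ψ_ε = φ_ε ⋆ φ̃_ε`, comb
`g = Σ_{m ≤ M} a_m φ_ε(· − log m)`, `k = g ⋆ g̃`, `Q(g) = W(k) = P(k) − Pr(k) + W_∞(k)`.

**Statement** (`weilQuadratic_comb_re_exactWindow_explicit`). For `0 < ε`, `1 ≤ M`, `2ε(M+1) ≤ 1`:

  `Re Q(g) = 2 Re( φ̂_ε(0) conj φ̂_ε(1) · A₋ conj A₊ )                       `  — pole, rank 2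
  `        − ε⁻¹ ‖φ₀‖₂² · 2 Re Σ_{m ≤ M} Σ_{n ≤ M/m} Λ(n) n^{-1/2} a(nm) conj a(m)`  — primes, EXACT Helson form
  `        + Re Σ_{m,m' ≤ M} a_m conj a_{m'} W_∞(τ_{log m − log m'} ψ_ε)          `  — archimedean Gram form

with `A₋ = Σ a_m m^{-1/2}`, `A₊ = Σ a_m m^{1/2}`, `φ̂_ε = weilMellin φ_ε`.  This assembles three landed
sub-goals: the exact prime term on the window (`weilQuadratic_comb_re_exactWindow`, p90904), the exact polar
term (`weilPolarTerm_comb_re`, p91841) and the archimedean Gram form (`weilArchTerm_comb_eq_sum`, p91497).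
The off-diagonal archimedean entries (`|log m − log m'| > 2ε` on the window) are given in Bombieri form by
`weilArchTerm_translate_psi_offdiag` (p91511): `W_∞(τ_x ψ_ε) = −∫₀^∞ e^{t/2}(ψ_ε(t−x) + ψ_ε(−t−x))/(2 sinh t) dt`.
Any proof of Theorem B starts from this bookkeeping, with pole and archimedean form kept whole and signed.
-/

noncomputable section

-- the sub-problem path RiemannHypothesis/RiemannHypothesis duplicates a namespace (D-0017)
set_option linter.dupNamespace false

open scoped BigOperators ComplexConjugate
open Complex

namespace Summit.RiemannHypothesis.RiemannHypothesis.Theorems.WeilCombBohrFejer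

open Literature.NumberTheory.LFunctions

/-- **Exact window identity, closed form.** On `2ε(M+1) ≤ 1`, `M ≥ 1`, `ε > 0`, the real part of the
Weil quadratic functional of the fixed-shape comb is: explicit rank-2 pole form, minus `ε⁻¹‖φ₀‖₂²` times the
von Mangoldt Helson form (exact prime term), plus the archimedean Gram form of the kernel
`x ↦ W_∞(τ_x ψ_ε)`. [folklore] -/
theorem weilQuadratic_comb_re_exactWindow_explicit : ∀ ε : ℝ, 0 < ε → ∀ (M : ℕ) (a : ℕ → ℂ), 1 ≤ M →
    2 * ε * ((M : ℝ) + 1) ≤ 1 →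
    (weilQuadratic (fun x : ℝ => ∑ m ∈ Finset.Icc 1 M,
        a m * ((ε : ℂ)⁻¹ * ((expNegInvGlue (1 - ((x - Real.log (m : ℝ)) / ε) ^ 2) : ℝ) : ℂ)))).re =
      2 * (weilMellin (fun t : ℝ => (ε : ℂ)⁻¹ * ((expNegInvGlue (1 - (t / ε) ^ 2) : ℝ) : ℂ)) 0 *
            conj (weilMellin (fun t : ℝ => (ε : ℂ)⁻¹ * ((expNegInvGlue (1 - (t / ε) ^ 2) : ℝ) : ℂ)) 1) *
          ((∑ m ∈ Finset.Icc 1 M, a m * ((Real.sqrt (m : ℝ) : ℝ) : ℂ)⁻¹) *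
            conj (∑ m ∈ Finset.Icc 1 M, a m * ((Real.sqrt (m : ℝ) : ℝ) : ℂ)))).re
        - ε⁻¹ * weilNorm2Sq (fun u : ℝ => ((expNegInvGlue (1 - u ^ 2) : ℝ) : ℂ)) *
            (2 * (∑ m ∈ Finset.Icc 1 M, ∑ n ∈ Finset.Icc 1 (M / m),
              ((ArithmeticFunction.vonMangoldt n : ℝ) : ℂ) / (Real.sqrt n : ℂ) * a (n * m) *
                conj (a m)).re)
        + (∑ m ∈ Finset.Icc 1 M, ∑ m' ∈ Finset.Icc 1 M,
            a m * conj (a m') *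
              weilArchTerm (weilTranslate
                (weilConv (fun t : ℝ => (ε : ℂ)⁻¹ * ((expNegInvGlue (1 - (t / ε) ^ 2) : ℝ) : ℂ))
                  (weilReflect (fun t : ℝ => (ε : ℂ)⁻¹ * ((expNegInvGlue (1 - (t / ε) ^ 2) : ℝ) : ℂ))))
                (Real.log (m : ℝ) - Real.log (m' : ℝ)))).re := by
  intro ε hε M a hM hw
  rw [weilQuadratic_comb_re_exactWindow ε hε M a hM hw, weilPolarTerm_comb_re ε hε M a,
    weilArchTerm_comb_eq_sum ε hε M a]

end Summit.RiemannHypothesis.RiemannHypothesis.Theorems.WeilCombBohrFejer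

end
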